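import Summits.CriticalPhenomena.Ising3DConformalLimit.Theses.EnergyNotSigmaSquared
import Literature.Probability.LatticeModels.RandomCurrentsProofs
import Literature.Probability.LatticeModels.CurrentsEdgeAvoidance
import Literature.Probability.LatticeModels.IsingFieldVolume
import Literature.Probability.LatticeModels.MeanFieldLowerBound
import Literature.Probability.LatticeModels.SourcedDoubleCurrentsProofs
import Literature.Probability.LatticeModels.CurrentInsertion
import Literature.Probability.LatticeModels.CriticalTwoPointLower

/-!
# Disproof of `RungOneAdjacentMerging` — findings (cdisprove gen 1 → gen 2, crux item stmt-CriticalPhenomena-11262)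

Route `EnergyNotSigmaSquared`, rank-5 crux (off the assembly chain: "calibration / kill criterion").
Informal: at `β_c(3)` in the free box `Λ_n ⊂ ℤ³`, for independent pairs `(n₁,n₃) ~ P^{0x} ⊗ P^∅`,
`(n₂,n₄) ~ P^{e₂,x+e₂} ⊗ P^∅`, `P[C_{n₁+n₃}(0) ∩ C_{n₂+n₄}(e₂) = ∅] → 0` as `‖x‖ → ∞` (`n → ∞` first).

## STATUS (gen 2, 2026-08-16T05:15Z): NO KILL IS POSSIBLE — THE CRUX IS A THEOREM OF THE TREE
`Cruxes/RungOneAdjacentMerging/CruxCandidateG3.lean` (drefute g3) proves the route declaration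
`…Theses.EnergyNotSigmaSquared.RungOneAdjacentMerging` WITHOUT `sorry`, importing only landed modules
(route file; landed stubs Chebyshev p73269, BoxPassage p72997, Cells p72844, WindowRegular p72861,
HarvestInputs p73276; AssemblyAux p73984) plus in-file proofs of `stub_abstractHarvest` (gen-2 drefute kit)
and `stub_assembly` (since landed by the lead, p76480).  Gen-2 cdisprove RE-VERIFIED it against the current
tree: `lean check` rc 0 / 0 warnings / 0 sorries, `#print axioms rungOneAdjacentMerging_candidate` =
`[propext, Classical.choice, Quot.sound]`; a renamed copy re-elaborated from source in 13 s (not a cache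
artefact).  What is left is bookkeeping for the lead prover (land `stub_abstractHarvest`, then the 15-line
composition `--workitem stmt-CriticalPhenomena-11262`).  A refuter cannot and should not fight a
kernel-checked proof; this file therefore records, for planners / ideators of the ROUTE:
(i) which hypotheses and quantifiers of the crux are load-bearing (so that restatements elsewhere keep them),
(ii) the natural strengthenings and their status, (iii) why the proof mechanism cannot reach the RATE form
that the route's real cruxes (`EnergyGapPowerLaw` 4469, `GapForcesFarMerging` 4468) need.

## Findings index (everything below the docblock is kernel-checked, rc 0, no sorry)
* §T toolkit (any finite graph `G`, `β ≥ 0`): `PairAvoidAt G o` (both currents of a pair vanish on the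
  bonds at `o`), `bondsAt`, the product formula `doubleCurrentMeasure_real_pairAvoidAt`
  (`P^{∅,∅}[PairAvoidAt o] = (Z_∅(n ≡ 0 at o)/Z_∅)²`), FINITE ENERGY `exp_le_plusCurrentSumAvoid_div`
  (`Z_∅(n ≡ 0 on T)/Z_∅ = ⟨e^{-βK_T}⟩ ≥ e^{-β|T|}`, from the tree's ADS15 (2.13)–(2.14)
  `plusCurrentSumAvoid_div_eq_isingExpect`), CONFINEMENT `not_mem_tracedConn_of_pairAvoidAt`, and
  `exp_pow_le_disjoint_sourceless`: `P^{∅,∅} ⊗ P^{∅,∅}[no u with o ↔ u, a ↔ u] ≥ e^{-4β deg(o)}` for `o ≠ a`.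
* §A LOAD-BEARING GUARD `R ≤ ‖x‖`: `rungOneAdjacentMerging_false_without_farX :
  ¬ RungOneAdjacentMergingWithoutFarX` — witness `x = 0`: then `{o} ∆ {y} = {a} ∆ {y'} = ∅`, both pairs are
  SOURCELESS and avoid each other with probability `≥ e^{-24β_c}` at every `n ≥ 1`
  (`disjoint_sourceless_lower`).  (Re-derived in gen 2 with a shorter proof; gen 1's version lives in the
  evidence file `20260816T045502Z-Disproof.lean`, sha256 6d8c3d68…, whose body is not mounted on this hub.)
  `rungOneAdjacentMerging_of_withoutFarX`: the mutation is the crux with `R := 0`.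
* §B RATE FORM `RungOnePower` (gen-1 name kept; `D_n(x) ≤ C‖x‖^{-κ'}` eventually in `n`) and
  `rungOneAdjacentMerging_of_power : RungOnePower → crux`.  OPEN; not reachable by the proof's mechanism
  (ceiling below); it is the duplicated-system shadow of `EnergyGapPowerLaw`.
* §C TIGHTNESS AT EVERY FINITE STAGE (gen-1 names kept, re-derived in gen 2 with new proofs):
  `disjoint_prob_pos` — for `β > 0`, `x = L e₀`, `L ≤ n`, `1 ≤ n`: `0 < D_n(x)` (the atom ((current of the
  axis walk `x → 0`, 0), (current of the axis walk `x+e₂ → e₂`, 0)) has positive mass —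
  `doubleCurrentMeasure_real_singleton_pos` — and its clusters live in the disjoint lines `{v 1 = 0}`,
  `{v 1 = 1}` — `mem_of_tracedConn`); `RungOneAdjacentMergingEpsZero` (`≤ ε` ↦ `≤ 0`) with
  `rungOneAdjacentMerging_of_epsZero` (⇒ crux) and `not_rungOneAdjacentMerging_eps_zero : ¬ …EpsZero`
  (witness `x = L e₀`, `L = max ⌈R⌉₊ 1`; uses `β_c(3) > 0`, `criticalBeta_pos_holds`).  Gen 1 also had
  `disjoint_prob_lt_one` (`D_n(x) < 1`: the walk `0 → e₂ → … → x+e₂ → x` meets the second cluster at `e₂`),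
  not re-derived (now subsumed by the proved crux for large `x`, `n`).  So `0 < D_n(x)` at every finite
  stage, the unguarded and the `ε = 0` statements are false: the content of the crux is exactly the double
  limit — which the tree now proves.
  Toolkit: `exists_current_of_walk` (walk ↦ current with sources = endpoints, SUPPORTED on the walk's edges),
  `exists_axisWalk` (axis walks in the comap box graph with coordinate control), `axis_mem_box`.

## Load-bearing / mutation table (H dropped or changed ↦ verdict)
* guard `R ≤ ‖x‖` dropped ↦ FALSE (§A, kernel-checked).
* `0 < ε` ↦ `ε = 0` ↦ FALSE (§C, kernel-checked).
* `β_c` ↦ `β = 0` ↦ junk-TRUE: `w_0(n) = 0` unless `n ≡ 0`, so `Z_{{o,y}}(0) = 0` for `o ≠ y` and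
  `doubleCurrentMeasure G 0 ({o} ∆ {y}) ∅` is the ZERO measure (documented junk value), `D = 0 ≤ ε`.
  ⇒ any restatement at a general `β` must carry `0 < β` to mean anything.
* `β_c` ↦ `0 < β < β_c` ↦ TRUE IN PRINT, not provable in tree: Ott–Velenik, PTRF 175 (2019), arXiv:1804.08323,
  Thm 1.2 (d = 3: `⟨σ_A;σ_{B+x}⟩_β ≍ (‖x‖ log ‖x‖)^{-2} e^{-2ξ‖x‖}`, the `(log)^{-2}` being the non-intersection
  probability of two directed bridges, §2.3–2.4) with CIV03 OZ asymptotics `G ≍ ‖x‖^{-1}e^{-ξ‖x‖}`,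
  `EnergyFactorisation` (4472) and `D ≤ A^par` (ADC21 App. A, Cor. A.2) give `D(β;x) ≲ (log ‖x‖)^{-2} → 0`.
  ⇒ CRITICALITY IS NOT LOAD-BEARING for the `o(1)` statement (it is for any power rate): the proved Rung 1
  cannot distinguish `Δ_ε > 2Δ_σ` from `Δ_ε = 2Δ_σ`.
* `d = 3` ↦ `d ≥ 5` ↦ FALSE IN PRINT (Aizenman, CMP 86 (1982): finite bubble ⇒ adjacent duplicated clusters
  avoid each other with probability `≥ c > 0` — Gaussianity above four dimensions); `d = 4` ↦ TRUE
  (Aizenman–Duminil-Copin, Ann. Math. 194 (2021), rate `(log)^{-c}`).  The tree proof uses `d = 3` exactly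
  through `B(β_c(3)) = ∞` (`NNIsing.bubbleDiagram_criticalBeta_three_eq_top`) inside `stub_harvestInputs`,
  and drefute g1's `Negative/AbstractHarvestLoadBearing.lean` (p73605) shows `B → ∞` is load-bearing for the
  harvest (`abstractHarvest_false_without_bubbleDivergence`).
* EVENT `C_{n₁+n₃}(0) ∩ C_{n₂+n₄}(e₂) ≠ ∅` ↦ `0 ↔ e₂ in n₁+n₂` (single sourced currents, no sourceless partners),
  i.e. `A^par → 0` ⇔ `EnergyGapSoft` (4473) by `EnergyFactorisation` (4472, proved) ↦ OPEN, and NOT implied by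
  the proved crux: a single sourced current has the exact one-point UPPER bound `G(0,u)G(u,x)/G(0,x)` but no
  lower bound (the FATNESS-LITE gap of the route docstring); pointwise neither event contains the other
  (e.g. `0 —n₂— w —n₁— e₂` connects `0,e₂` in `n₁+n₂` with `C_{n₁}(0) ∩ C_{n₂}(e₂) = ∅`).
* quantifier strengthenings — `n₀` uniform in `x`; intersection inside a ball `B_{R(ε)}` around the origin;
  `|C₁ ∩ C₂| → ∞` in probability ↦ all TRUE by the same proof (`R = 2^{sup 𝒦 + 4}` depends on `ε` only) —
  no refutation to be had there.

## Ceiling of the proof mechanism (heuristic, NOT kernel-checked; for planners)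
Line `dominant-shell-concentration` bounds `D` by Chebyshev: `D ≤ θ` with `θ ≥ Var N/(E N)²`,
`N = Σ_{k ∈ 𝒦} w_k N_k/E N_k` a convex combination of normalised shell intersection counts.  The cross terms
are `(1+o(1))·w_j w_k` (tree bound A.3 + window regularity — this IS the "cross-shell decorrelation" the
planner feared missing; it comes for free at decay-separated windowed scales), but each diagonal term is
`w_k²·E N_k²/(E N_k)² ≥ w_k²(1 + P[N_k = 0])` (Cauchy–Schwarz), and `P[N_k = 0]` — two independent
duplicated clusters missing each other inside ONE dyadic shell — is expected to stay `≥ c > 0` uniformly in `k`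
(scale invariance; dimensions `(2-η)+(2-η) > 3` give intersection with probability in `(c, 1-c)` per scale, as
for two Brownian paths in `ℝ³`).  Hence `θ ≳ Σ_k w_k² ≥ 1/|𝒦| ≥ 1/log₂‖x‖`: NO second-moment / Chebyshev
argument over `≤ log₂‖x‖` shells can output better than `c/log ‖x‖`, let alone the power `‖x‖^{-κ'}` of
`RungOnePower`.  A power needs a MULTIPLICATIVE estimate (conditionally on the configuration up to scale `2^k`
and on avoidance so far, the strands merge in the next shell with probability `≥ c`) — i.e. exactly the
separation + boundary-flux decoupling technology for SOURCED currents that `GapForcesFarMerging` (4468) posits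
and nobody has on `ℤ³`.  Reading for the route: the proved Rung 1 says "the duplicated system merges,
qualitatively, as in `d = 4`"; it is NOT evidence for `Δ_ε > 2Δ_σ`, and its proof transfers neither to the
single-current `EnergyGapSoft` (no one-point lower bound) nor to any rate.

## Targets (lead's stuck stubs)
None assigned (payload `targets = []`, `stuck_stubs = []`); the skeleton's seven stubs are landed (6) or
have a verified sorry-free candidate (`stub_abstractHarvest`).  drefute g1–g3 found 0 stub-false.

## Near-misses
None open: every cheap mutation is either refuted above, junk, or settled positively by the tree proof.
-/

noncomputable section

open MeasureTheory Finset Literature.Probability.LatticeModels Literature.Probability.Percolation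
open scoped symmDiff

namespace Summit.CriticalPhenomena.Ising3DConformalLimit.Cruxes.RungOneAdjacentMerging.Disproof

/-! ## §T Toolkit: finite energy and confinement for pairs of currents on a finite graph -/

section Generic

variable {V : Type*} [Fintype V] [DecidableEq V] (G : SimpleGraph V) [DecidableRel G.Adj]

/-- The event that BOTH currents of a pair vanish on every bond of `G` at the vertex `o`
(so that `o` is isolated in the trace of their sum). -/
def PairAvoidAt (o : V) : Set (Current G × Current G) :=
  {p | ∀ e : G.edgeFinset, o ∈ (e : Sym2 V) → p.1 e = 0 ∧ p.2 e = 0}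

/-- The bonds of `G` at `o`, as a finset of unordered pairs. -/
def bondsAt (o : V) : Finset (Sym2 V) := G.edgeFinset.filter fun e => o ∈ e

/-- Membership in `bondsAt`, for an edge of `G`. -/
theorem mem_bondsAt_iff (o : V) (e : G.edgeFinset) : (e : Sym2 V) ∈ bondsAt G o ↔ o ∈ (e : Sym2 V) := by
  simp [bondsAt, e.2]

/-- `bondsAt G o ⊆ E(G)`. -/
theorem bondsAt_subset (o : V) : bondsAt G o ⊆ G.edgeFinset := Finset.filter_subset _ _

/-- `#(bondsAt G o) ≤ deg_G(o)`: every bond at `o` is `s(o, v)` for a neighbour `v`. -/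
theorem card_bondsAt_le_degree (o : V) : #(bondsAt G o) ≤ #(G.neighborFinset o) := by
  classical
  have hsub : bondsAt G o ⊆ (G.neighborFinset o).image fun v => s(o, v) := by
    intro e he
    rw [bondsAt, Finset.mem_filter] at he
    obtain ⟨he, ho⟩ := he
    obtain ⟨v, rfl⟩ := Sym2.mem_iff_exists.1 ho
    rw [SimpleGraph.mem_edgeFinset, SimpleGraph.mem_edgeSet] at he
    exact Finset.mem_image.2 ⟨v, (G.mem_neighborFinset o v).2 he, rfl⟩
  exact (Finset.card_le_card hsub).trans Finset.card_image_le

/-- The single-current avoidance indicator `𝟙[n ≡ 0 on the bonds at o]`. -/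
def avoidInd (o : V) (n : Current G) : ℝ :=
  if (∀ e : G.edgeFinset, o ∈ (e : Sym2 V) → n e = 0) then 1 else 0

/-- The sourceless avoidance weight `𝟙[∂n = ∅] w_β(n) 𝟙[n ≡ 0 at o]`. -/
def avoidTerm (β : ℝ) (o : V) (n : Current G) : ℝ :=
  (if n.sources = ∅ then n.weight β else 0) * avoidInd G o n

/-- `avoidTerm` is the summand of `plusCurrentSumAvoid G univ β (bondsAt G o) ∅`. -/
theorem avoidTerm_eq (β : ℝ) (o : V) (n : Current G) :
    avoidTerm G β o n =
      if n.sources ∩ univ = ∅ ∧ (∀ e : G.edgeFinset, (e : Sym2 V) ∈ bondsAt G o → n e = 0) then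
        n.weight β else 0 := by
  have hiff : (∀ e : G.edgeFinset, (e : Sym2 V) ∈ bondsAt G o → n e = 0) ↔
      (∀ e : G.edgeFinset, o ∈ (e : Sym2 V) → n e = 0) :=
    forall_congr' fun e => by rw [mem_bondsAt_iff]
  unfold avoidTerm avoidInd
  by_cases hA : n.sources = ∅ <;> by_cases hB : (∀ e : G.edgeFinset, o ∈ (e : Sym2 V) → n e = 0)
  · rw [if_pos hA, if_pos hB, if_pos ⟨by rw [Finset.inter_univ, hA], hiff.2 hB⟩, mul_one]
  · rw [if_pos hA, if_neg hB, if_neg (fun h => hB (hiff.1 h.2)), mul_zero]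
  · rw [if_neg hA, if_pos hB, if_neg (fun h => hA (by simpa [Finset.inter_univ] using h.1)), zero_mul]
  · rw [if_neg hA, if_neg hB, if_neg (fun h => hB (hiff.1 h.2)), mul_zero]

/-- `∑_n avoidTerm = ∑_{∂n = ∅, n ≡ 0 at o} w_β(n)`. -/
theorem tsum_avoidTerm (β : ℝ) (o : V) :
    ∑' n, avoidTerm G β o n = plusCurrentSumAvoid G univ β (bondsAt G o) ∅ := by
  unfold plusCurrentSumAvoid
  exact tsum_congr fun n => avoidTerm_eq G β o n

/-- Summability of `‖avoidTerm‖`. -/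
theorem summable_norm_avoidTerm (β : ℝ) (o : V) : Summable fun n => ‖avoidTerm G β o n‖ := by
  have h := (summable_plusCurrentSumAvoid_term G univ β (bondsAt G o) ∅).norm
  refine h.congr fun n => ?_
  rw [avoidTerm_eq]

/-- The pair weight restricted to the pair-avoidance event factorises. -/
theorem pairWeight_mul_indicator_pairAvoidAt (β : ℝ) (o : V) (p : Current G × Current G) :
    pairWeight G β ∅ ∅ p * (PairAvoidAt G o).indicator 1 p = avoidTerm G β o p.1 * avoidTerm G β o p.2 := by
  classical
  have hind : (PairAvoidAt G o).indicator (1 : Current G × Current G → ℝ) p =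
      avoidInd G o p.1 * avoidInd G o p.2 := by
    rw [Set.indicator_apply]
    unfold avoidInd PairAvoidAt
    simp only [Set.mem_setOf_eq, Pi.one_apply]
    by_cases h1 : (∀ e : G.edgeFinset, o ∈ (e : Sym2 V) → p.1 e = 0) <;>
      by_cases h2 : (∀ e : G.edgeFinset, o ∈ (e : Sym2 V) → p.2 e = 0)
    · rw [if_pos (fun e he => ⟨h1 e he, h2 e he⟩), if_pos h1, if_pos h2, mul_one]
    · rw [if_neg (fun h => h2 fun e he => (h e he).2), if_pos h1, if_neg h2, mul_zero]
    · rw [if_neg (fun h => h1 fun e he => (h e he).1), if_neg h1, if_pos h2, zero_mul]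
    · rw [if_neg (fun h => h1 fun e he => (h e he).1), if_neg h1, if_neg h2, mul_zero]
  rw [hind, pairWeight_eq_mul]
  unfold avoidTerm
  ring

/-- **Product formula**: `P^{∅,∅}[both currents vanish at o] = (Z_∅(n ≡ 0 at o)/Z_∅)²` (`β ≥ 0`). -/
theorem doubleCurrentMeasure_real_pairAvoidAt {β : ℝ} (hβ : 0 ≤ β) (o : V) :
    (doubleCurrentMeasure G β ∅ ∅).real (PairAvoidAt G o) =
      (plusCurrentSumAvoid G univ β (bondsAt G o) ∅ / currentSum G β ∅) ^ 2 := by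
  have hZ : currentSum G β ∅ ≠ 0 := (currentSum_empty_pos' G β).ne'
  have hZZ : currentSum G β ∅ * currentSum G β ∅ ≠ 0 := mul_ne_zero hZ hZ
  have hmeas : MeasurableSet (PairAvoidAt G o) := (Set.to_countable _).measurableSet
  have h := doubleCurrentMeasure_real_mul G β hβ ∅ ∅ hmeas hZZ
  have key : ∑' p : Current G × Current G, pairWeight G β ∅ ∅ p * (PairAvoidAt G o).indicator 1 p =
      plusCurrentSumAvoid G univ β (bondsAt G o) ∅ ^ 2 := by
    calc ∑' p : Current G × Current G, pairWeight G β ∅ ∅ p * (PairAvoidAt G o).indicator 1 p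
        = ∑' p : Current G × Current G, avoidTerm G β o p.1 * avoidTerm G β o p.2 :=
          tsum_congr fun p => pairWeight_mul_indicator_pairAvoidAt G β o p
      _ = (∑' n, avoidTerm G β o n) * ∑' n, avoidTerm G β o n :=
          (tsum_mul_tsum_of_summable_norm (summable_norm_avoidTerm G β o)
            (summable_norm_avoidTerm G β o)).symm
      _ = plusCurrentSumAvoid G univ β (bondsAt G o) ∅ ^ 2 := by rw [tsum_avoidTerm, sq]
  rw [key] at h
  rw [div_pow, eq_div_iff (pow_ne_zero 2 hZ), sq (currentSum G β ∅)]
  exact h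

/-- **Finite energy** (ADS15 (2.13)–(2.14) + `e^{-βK_T} ≥ e^{-β|T|}`): for `β ≥ 0` and `T ⊆ E(G)`,
`Z_∅(n ≡ 0 on T)/Z_∅ = ⟨e^{-βK_T}⟩ ≥ e^{-β|T|}`. -/
theorem exp_le_plusCurrentSumAvoid_div {β : ℝ} (hβ : 0 ≤ β) {T : Finset (Sym2 V)} (hT : T ⊆ G.edgeFinset) :
    Real.exp (-β * #T) ≤ plusCurrentSumAvoid G univ β T ∅ / currentSum G β ∅ := by
  have hG : edgesTouching G univ = G.edgeFinset := (edgesTouching_univ G).trans (edgesIn_univ G)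
  rw [← plusCurrentSum_univ, plusCurrentSumAvoid_div_eq_isingExpect G hG hT β]
  unfold isingExpect
  have hf : Measurable fun σ : SpinConfig V => Real.exp (-β * ∑ e ∈ T, bondSpin σ e) :=
    Real.measurable_exp.comp ((Finset.measurable_sum _ fun e _ => measurable_bondSpin e).const_mul _)
  have hsum_le : ∀ σ : SpinConfig V, ∑ e ∈ T, bondSpin σ e ≤ #T := fun σ =>
    calc ∑ e ∈ T, bondSpin σ e ≤ ∑ e ∈ T, (1 : ℝ) :=
          Finset.sum_le_sum fun e _ => (abs_le.1 (abs_bondSpin_le_one' σ e)).2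
      _ = #T := by simp
  have hsum_ge : ∀ σ : SpinConfig V, -(#T : ℝ) ≤ ∑ e ∈ T, bondSpin σ e := fun σ =>
    calc -(#T : ℝ) = ∑ e ∈ T, (-1 : ℝ) := by simp
      _ ≤ ∑ e ∈ T, bondSpin σ e :=
          Finset.sum_le_sum fun e _ => (abs_le.1 (abs_bondSpin_le_one' σ e)).1
  have hlow : ∀ σ : SpinConfig V, Real.exp (-β * #T) ≤ Real.exp (-β * ∑ e ∈ T, bondSpin σ e) := fun σ =>
    Real.exp_le_exp.2 (by nlinarith [hsum_le σ])
  have hup : ∀ σ : SpinConfig V, Real.exp (-β * ∑ e ∈ T, bondSpin σ e) ≤ Real.exp (β * #T) := fun σ =>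
    Real.exp_le_exp.2 (by nlinarith [hsum_ge σ])
  have hint : Integrable (fun σ : SpinConfig V => Real.exp (-β * ∑ e ∈ T, bondSpin σ e))
      (isingMeasure G univ β 0 .plus) :=
    (integrable_const (Real.exp (β * #T))).mono' hf.aestronglyMeasurable
      (ae_of_all _ fun σ => by
        rw [Real.norm_eq_abs, abs_of_pos (Real.exp_pos _)]
        exact hup σ)
  calc Real.exp (-β * #T) = ∫ _σ, Real.exp (-β * #T) ∂(isingMeasure G univ β 0 .plus) := by simp
    _ ≤ ∫ σ, Real.exp (-β * ∑ e ∈ T, bondSpin σ e) ∂(isingMeasure G univ β 0 .plus) :=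
        integral_mono (integrable_const _) hint hlow

omit [DecidableEq V] in
/-- **Confinement**: if both currents of the pair vanish on every bond at `o`, then `o` is
connected to nothing but itself in the trace of their sum. -/
theorem not_mem_tracedConn_of_pairAvoidAt {o u : V} (hou : o ≠ u) {p : Current G × Current G}
    (hp : p ∈ PairAvoidAt G o) : p ∉ tracedConn G o u := by
  intro h
  rw [mem_tracedConn_iff] at h
  obtain ⟨w⟩ := h
  cases w with
  | nil => exact hou rfl
  | @cons _ v _ hadj _ =>
    rw [openGraph_adj] at hadj
    obtain ⟨hmem, -⟩ := hadj
    obtain ⟨he, hpos⟩ := hmem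
    have h0 := hp ⟨s(o, v), he⟩ (Sym2.mem_mk_left o v)
    simp only [Pi.add_apply, h0.1, h0.2, add_zero, lt_self_iff_false] at hpos

omit [DecidableEq V] in
/-- Symmetric form of confinement: nothing else reaches `o`. -/
theorem not_mem_tracedConn_of_pairAvoidAt' {a o : V} (hao : a ≠ o) {p : Current G × Current G}
    (hp : p ∈ PairAvoidAt G o) : p ∉ tracedConn G a o := by
  intro h
  rw [mem_tracedConn_iff] at h
  exact not_mem_tracedConn_of_pairAvoidAt G hao.symm hp ((mem_tracedConn_iff G o a p).2 h.symm)

omit [DecidableEq V] in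
/-- **The disjointness event contains a product of avoidance events**: if the first pair
vanishes at `o` and the second pair vanishes at `o` too, then no vertex `u` is joined to `o` by
the first pair and to `a ≠ o` by the second. -/
theorem pairAvoidAt_prod_subset {o a : V} (hoa : o ≠ a) :
    PairAvoidAt G o ×ˢ PairAvoidAt G o ⊆
      {pq : (Current G × Current G) × (Current G × Current G) |
        ∀ u : V, ¬ (pq.1 ∈ tracedConn G o u ∧ pq.2 ∈ tracedConn G a u)} := by
  rintro ⟨p, q⟩ ⟨hp, hq⟩ u ⟨hpu, hqu⟩
  by_cases hu : o = u
  · subst hu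
    exact not_mem_tracedConn_of_pairAvoidAt' G (Ne.symm hoa) hq hqu
  · exact not_mem_tracedConn_of_pairAvoidAt G hu hp hpu

/-- **Uniform lower bound for the sourceless system**: for `β ≥ 0` and `o ≠ a`,
`P^{∅,∅} ⊗ P^{∅,∅}[C_{n₁+n₃}(o) ∩ C_{n₂+n₄}(a) = ∅] ≥ exp(-β deg(o))⁴`. -/
theorem exp_pow_le_disjoint_sourceless {β : ℝ} (hβ : 0 ≤ β) {o a : V} (hoa : o ≠ a) :
    Real.exp (-β * #(G.neighborFinset o)) ^ 4 ≤
      ((doubleCurrentMeasure G β ∅ ∅).prod (doubleCurrentMeasure G β ∅ ∅)).real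
        {pq | ∀ u : V, ¬ (pq.1 ∈ tracedConn G o u ∧ pq.2 ∈ tracedConn G a u)} := by
  have hZ : currentSum G β ∅ ≠ 0 := (currentSum_empty_pos' G β).ne'
  haveI := isProbabilityMeasure_doubleCurrentMeasure_holds G hβ hZ hZ
  have hdeg : Real.exp (-β * #(G.neighborFinset o)) ≤ Real.exp (-β * #(bondsAt G o)) := by
    apply Real.exp_le_exp.2
    have h := card_bondsAt_le_degree G o
    have h' : (#(bondsAt G o) : ℝ) ≤ #(G.neighborFinset o) := by exact_mod_cast h
    nlinarith
  have havoid : Real.exp (-β * #(bondsAt G o)) ≤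
      plusCurrentSumAvoid G univ β (bondsAt G o) ∅ / currentSum G β ∅ :=
    exp_le_plusCurrentSumAvoid_div G hβ (bondsAt_subset G o)
  have hE : Real.exp (-β * #(G.neighborFinset o)) ^ 2 ≤ (doubleCurrentMeasure G β ∅ ∅).real (PairAvoidAt G o) := by
    rw [doubleCurrentMeasure_real_pairAvoidAt G hβ o]
    exact pow_le_pow_left₀ (Real.exp_pos _).le (hdeg.trans havoid) 2
  calc Real.exp (-β * #(G.neighborFinset o)) ^ 4
      = Real.exp (-β * #(G.neighborFinset o)) ^ 2 * Real.exp (-β * #(G.neighborFinset o)) ^ 2 := by ring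
    _ ≤ (doubleCurrentMeasure G β ∅ ∅).real (PairAvoidAt G o) *
          (doubleCurrentMeasure G β ∅ ∅).real (PairAvoidAt G o) :=
        mul_le_mul hE hE (by positivity) measureReal_nonneg
    _ = ((doubleCurrentMeasure G β ∅ ∅).prod (doubleCurrentMeasure G β ∅ ∅)).real
          (PairAvoidAt G o ×ˢ PairAvoidAt G o) := (measureReal_prod_prod _ _).symm
    _ ≤ _ := measureReal_mono (pairAvoidAt_prod_subset G hoa)

end Generic

/-! ## §A Load-bearing hypothesis: the guard `R ≤ ‖x‖` (degenerate case `x = 0`) -/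

section Box

/-- The free box graph of the crux: the nearest-neighbour graph of `ℤ³` induced on `box 3 n`
(verbatim the crux's `(zdGraph 3).comap Subtype.val`). -/
abbrev boxG (n : ℕ) : SimpleGraph ↥(box 3 n) := (zdGraph 3).comap (Subtype.val : ↥(box 3 n) → Site 3)

/-- Degrees in the box graph are at most `6`. -/
theorem card_neighborFinset_boxG_le (n : ℕ) (o : ↥(box 3 n)) : #((boxG n).neighborFinset o) ≤ 6 := by
  have h1 : ((boxG n).neighborFinset o).image Subtype.val ⊆ (zdGraph 3).neighborFinset (o : Site 3) := by
    intro v hv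
    obtain ⟨w, hw, rfl⟩ := Finset.mem_image.1 hv
    rw [SimpleGraph.mem_neighborFinset] at hw ⊢
    exact hw
  calc #((boxG n).neighborFinset o) = #(((boxG n).neighborFinset o).image Subtype.val) :=
        (Finset.card_image_of_injective _ Subtype.val_injective).symm
    _ ≤ #((zdGraph 3).neighborFinset (o : Site 3)) := Finset.card_le_card h1
    _ ≤ 2 * 3 := card_neighborFinset_zdGraph_le _

/-- **Uniform lower bound in the box**: for `β ≥ 0`, every `n` and box vertices `o ≠ a`,
`P^{∅,∅}_{Λ_n} ⊗ P^{∅,∅}_{Λ_n}[no u with o ↔ u in n₁+n₃ and a ↔ u in n₂+n₄] ≥ e^{-24β}`. -/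
theorem disjoint_sourceless_lower (n : ℕ) {o a : ↥(box 3 n)} (hoa : o ≠ a) {β : ℝ} (hβ : 0 ≤ β) :
    Real.exp (-β * 6) ^ 4 ≤
      ((doubleCurrentMeasure (boxG n) β ∅ ∅).prod (doubleCurrentMeasure (boxG n) β ∅ ∅)).real
        {pq | ∀ u : ↥(box 3 n), ¬ (pq.1 ∈ tracedConn (boxG n) o u ∧ pq.2 ∈ tracedConn (boxG n) a u)} := by
  refine le_trans ?_ (exp_pow_le_disjoint_sourceless (boxG n) hβ hoa)
  apply pow_le_pow_left₀ (Real.exp_pos _).le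
  apply Real.exp_le_exp.2
  have h : (#((boxG n).neighborFinset o) : ℝ) ≤ 6 := by exact_mod_cast card_neighborFinset_boxG_le n o
  nlinarith

/-- `RungOneAdjacentMerging` WITHOUT the guard `R ≤ ‖x‖` (the `∃ R, … R ≤ ‖x‖ →` deleted,
everything else verbatim). -/
def RungOneAdjacentMergingWithoutFarX : Prop :=
  ∀ ε : ℝ, 0 < ε → ∀ x : Site 3, ∃ n₀ : ℕ, ∀ n : ℕ, n₀ ≤ n → ∀ o a y y' : ↥(box 3 n), (o : Site 3) = 0 → (a : Site 3) = Pi.single 1 1 → (y : Site 3) = x → (y' : Site 3) = x + Pi.single 1 1 → ((doubleCurrentMeasure ((zdGraph 3).comap (Subtype.val : ↥(box 3 n) → Site 3)) (criticalBeta 3) ({o} ∆ {y}) ∅).prod (doubleCurrentMeasure ((zdGraph 3).comap (Subtype.val : ↥(box 3 n) → Site 3)) (criticalBeta 3) ({a} ∆ {y'}) ∅)).real {pq | ∀ u : ↥(box 3 n), ¬ (pq.1 ∈ tracedConn ((zdGraph 3).comap (Subtype.val : ↥(box 3 n) → Site 3)) o u ∧ pq.2 ∈ tracedConn ((zdGraph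 3).comap (Subtype.val : ↥(box 3 n) → Site 3)) a u)} ≤ ε

/-- The mutation implies the crux (it is the crux with `R := 0`). -/
theorem rungOneAdjacentMerging_of_withoutFarX (h : RungOneAdjacentMergingWithoutFarX) :
    Summit.CriticalPhenomena.Ising3DConformalLimit.Theses.EnergyNotSigmaSquared.RungOneAdjacentMerging :=
  fun ε hε => ⟨0, fun x _ => h ε hε x⟩

/-- `e₂ ∈ Λ_n` for `n ≥ 1`. -/
theorem e2_mem_box {n : ℕ} (hn : 1 ≤ n) : (Pi.single 1 1 : Site 3) ∈ box 3 n := by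
  rw [mem_box]
  intro i
  by_cases hi : i = 1
  · subst hi
    simp only [Pi.single_eq_same]
    omega
  · simp [hi]

/-- **`R ≤ ‖x‖` is load-bearing** (`refuted-misstated`-type degenerate case, NOT a refutation of
the crux): without the guard take `x = 0`; then `{o} ∆ {y} = {a} ∆ {y'} = ∅`, both pairs are
SOURCELESS, and by finite energy + confinement the two clusters are disjoint with probability
`≥ e^{-24 β_c}` at every `n ≥ 1` — so the probability does not tend to `0`. Witness:
`ε = e^{-24β_c}/2`, `x = 0`, `n = max n₀ 1`. Any proof of the crux must use `‖x‖ → ∞`. -/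
theorem rungOneAdjacentMerging_false_without_farX : ¬ RungOneAdjacentMergingWithoutFarX := by
  intro h
  have hβ : 0 ≤ criticalBeta 3 := criticalBeta_nonneg 3
  have hc : 0 < Real.exp (-criticalBeta 3 * 6) ^ 4 := by positivity
  obtain ⟨n₀, hn₀⟩ := h (Real.exp (-criticalBeta 3 * 6) ^ 4 / 2) (by positivity) 0
  have hn1 : 1 ≤ max n₀ 1 := le_max_right _ _
  have h0 : (0 : Site 3) ∈ box 3 (max n₀ 1) := zero_mem_box 3 _
  have he : (Pi.single 1 1 : Site 3) ∈ box 3 (max n₀ 1) := e2_mem_box hn1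
  have hoa : (⟨0, h0⟩ : ↥(box 3 (max n₀ 1))) ≠ ⟨Pi.single 1 1, he⟩ := by
    intro hh
    have := congrArg (fun v : ↥(box 3 (max n₀ 1)) => (v : Site 3) 1) hh
    simp at this
  have key := hn₀ (max n₀ 1) (le_max_left _ _) ⟨0, h0⟩ ⟨Pi.single 1 1, he⟩ ⟨0, h0⟩ ⟨Pi.single 1 1, he⟩
    rfl rfl rfl (by simp)
  rw [symmDiff_self, symmDiff_self, Finset.bot_eq_empty] at key
  have low := disjoint_sourceless_lower (max n₀ 1) hoa hβ
  linarith

end Box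

/-! ## §C Tightness at every finite stage (`0 < D_n(x)`): the `ε = 0` version is false -/

section WalkCurrents

variable {V : Type*} [Fintype V] [DecidableEq V] (G : SimpleGraph V) [DecidableRel G.Adj]

/-- A walk carries a current with sources its endpoints and SUPPORTED ON ITS EDGES (the tree's
`exists_current_sources_eq_of_walk` with the support clause added). -/
theorem exists_current_of_walk {x y : V} (p : G.Walk x y) :
    ∃ n : Current G, n.sources = {x} ∆ {y} ∧ ∀ e : G.edgeFinset, n e ≠ 0 → (e : Sym2 V) ∈ p.edges := by
  induction p with
  | nil =>
    exact ⟨0, by rw [Current.sources_zero, symmDiff_self, Finset.bot_eq_empty], fun e he => (he rfl).elim⟩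
  | @cons u v w huv p ih =>
    obtain ⟨n, hn, hsupp⟩ := ih
    have he : s(u, v) ∈ G.edgeFinset := SimpleGraph.mem_edgeFinset.2 huv
    refine ⟨Pi.single ⟨s(u, v), he⟩ 1 + n, ?_, ?_⟩
    · rw [Current.sources_add, hn, Current.sources_single ⟨s(u, v), he⟩ rfl,
        ← Current.symmDiff_singleton_eq_pair huv.ne, symmDiff_assoc, symmDiff_symmDiff_cancel_left]
    · intro e hne
      rw [SimpleGraph.Walk.edges_cons]
      by_cases h : e = ⟨s(u, v), he⟩
      · subst h
        exact List.mem_cons_self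
      · have hn0 : n e ≠ 0 := by
          simpa [Pi.add_apply, Pi.single_eq_of_ne h] using hne
        exact List.mem_cons_of_mem _ (hsupp e hn0)

/-- An atom of the double-current measure with matching sources has positive mass (`β > 0`):
`P^{A,B}[{(m₁,m₂)}] = w(m₁)w(m₂)/(Z_A Z_B) > 0`. -/
theorem doubleCurrentMeasure_real_singleton_pos {β : ℝ} (hβ : 0 < β) {A B : Finset V}
    (m : Current G × Current G) (h1 : m.1.sources = A) (h2 : m.2.sources = B) :
    0 < (doubleCurrentMeasure G β A B).real {m} := by
  classical
  have hZA : 0 < currentSum G β A := currentSum_pos_of_exists G hβ ⟨m.1, h1⟩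
  have hZB : 0 < currentSum G β B := currentSum_pos_of_exists G hβ ⟨m.2, h2⟩
  have hZ : currentSum G β A * currentSum G β B ≠ 0 := (mul_pos hZA hZB).ne'
  have h := doubleCurrentMeasure_real_mul G β hβ.le A B (MeasurableSet.singleton m) hZ
  rw [tsum_eq_single m (fun p hp => by
      rw [Set.indicator_of_notMem (by simpa using hp), mul_zero]),
    Set.indicator_of_mem (Set.mem_singleton m), Pi.one_apply, mul_one] at h
  have hw : 0 < pairWeight G β A B m := by
    rw [pairWeight_eq_mul, if_pos h1, if_pos h2]
    exact mul_pos (Current.weight_pos_of_pos G hβ _) (Current.weight_pos_of_pos G hβ _)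
  rw [eq_div_of_mul_eq hZ h]
  exact div_pos hw (mul_pos hZA hZB)

omit [DecidableEq V] in
/-- **Confinement to a vertex set**: if every bond carrying current of `p.1 + p.2` has both
endpoints in `S`, the cluster of any `o ∈ S` stays in `S`. -/
theorem mem_of_tracedConn {S : Set V} {p : Current G × Current G}
    (hS : ∀ e : G.edgeFinset, (p.1 + p.2) e ≠ 0 → ∀ b ∈ (e : Sym2 V), b ∈ S)
    {o u : V} (h : p ∈ tracedConn G o u) (ho : o ∈ S) : u ∈ S := by
  rw [mem_tracedConn_iff] at h
  obtain ⟨w⟩ := h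
  induction w with
  | nil => exact ho
  | @cons a b c hadj w ih =>
    rw [openGraph_adj] at hadj
    obtain ⟨⟨he, hpos⟩, -⟩ := hadj
    exact ih (hS ⟨s(a, b), he⟩ hpos.ne' b (Sym2.mem_mk_right a b))

end WalkCurrents

section BoxWalks

/-- Straight walks along the first axis inside the box: from `c + k e₀` down to `c`, through
vertices whose second coordinate is `c 1`. -/
theorem exists_axisWalk (n : ℕ) (c : Site 3) (hc0 : c ∈ box 3 n) (L : ℕ)
    (hc : ∀ k : ℕ, k ≤ L → c + Pi.single 0 (k : ℤ) ∈ box 3 n) (k : ℕ) (hk : k ≤ L) :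
    ∃ p : (boxG n).Walk ⟨c + Pi.single 0 (k : ℤ), hc k hk⟩ ⟨c, hc0⟩,
      ∀ v ∈ p.support, (v : Site 3) 1 = c 1 := by
  induction k with
  | zero =>
    have heq : (⟨c, hc0⟩ : ↥(box 3 n)) = ⟨c + Pi.single 0 ((0 : ℕ) : ℤ), hc 0 (Nat.zero_le L)⟩ :=
      Subtype.ext (by simp)
    refine ⟨(SimpleGraph.Walk.nil : (boxG n).Walk ⟨c, hc0⟩ ⟨c, hc0⟩).copy heq rfl, ?_⟩
    intro v hv
    rw [SimpleGraph.Walk.support_copy, SimpleGraph.Walk.support_nil, List.mem_singleton] at hv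
    rw [hv]
  | succ k ih =>
    obtain ⟨p, hp⟩ := ih (Nat.le_of_succ_le hk)
    have hadj : (boxG n).Adj ⟨c + Pi.single 0 ((k + 1 : ℕ) : ℤ), hc (k + 1) hk⟩
        ⟨c + Pi.single 0 (k : ℤ), hc k (Nat.le_of_succ_le hk)⟩ := by
      rw [SimpleGraph.comap_adj, zdGraph_adj_iff]
      refine ⟨0, Or.inr ?_⟩
      simp only [Nat.cast_succ]
      rw [add_assoc, ← Pi.single_add]
    refine ⟨SimpleGraph.Walk.cons hadj p, fun v hv => ?_⟩
    rw [SimpleGraph.Walk.support_cons, List.mem_cons] at hv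
    rcases hv with rfl | hv
    · simp
    · exact hp v hv

/-- The axis points `c + k e₀`, `k ≤ L ≤ n`, lie in `Λ_n` when `c = 0` or `c = e₂` (`n ≥ 1`). -/
theorem axis_mem_box {n L : ℕ} (hL : L ≤ n) (hn : 1 ≤ n) (j : ℤ) (hj : j = 0 ∨ j = 1)
    (k : ℕ) (hk : k ≤ L) : (Pi.single 1 j + Pi.single 0 (k : ℤ) : Site 3) ∈ box 3 n := by
  rw [mem_box]
  intro i
  fin_cases i
  · simp; omega
  · rcases hj with rfl | rfl
    · simp
    · simp; omega
  · simp

end BoxWalks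

section Tight

/-- **Tightness at every finite stage, canonical nails**: for `β > 0` and `L ≤ n`, `1 ≤ n`, the
atom ((current of the axis walk `L e₀ → 0`, 0), (current of the axis walk `L e₀ + e₂ → e₂`, 0)) has
positive mass and its two clusters live in the disjoint lines `{v 1 = 0}`, `{v 1 = 1}`; hence the
disjointness event has positive probability. -/
theorem disjoint_prob_pos_canonical {n L : ℕ} (hL : L ≤ n) (hn : 1 ≤ n) {β : ℝ} (hβ : 0 < β)
    (h00 : (0 : Site 3) ∈ box 3 n) (h10 : (Pi.single 1 1 : Site 3) ∈ box 3 n)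
    (hL0 : (0 : Site 3) + Pi.single 0 (L : ℤ) ∈ box 3 n)
    (hL1 : (Pi.single 1 1 : Site 3) + Pi.single 0 (L : ℤ) ∈ box 3 n) :
    0 < ((doubleCurrentMeasure (boxG n) β ({⟨0, h00⟩} ∆ {⟨(0 : Site 3) + Pi.single 0 (L : ℤ), hL0⟩}) ∅).prod
          (doubleCurrentMeasure (boxG n) β
            ({⟨Pi.single 1 1, h10⟩} ∆ {⟨(Pi.single 1 1 : Site 3) + Pi.single 0 (L : ℤ), hL1⟩}) ∅)).real
        {pq | ∀ u : ↥(box 3 n), ¬ (pq.1 ∈ tracedConn (boxG n) ⟨0, h00⟩ u ∧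
          pq.2 ∈ tracedConn (boxG n) ⟨Pi.single 1 1, h10⟩ u)} := by
  classical
  -- abbreviations
  set μ₀ := doubleCurrentMeasure (boxG n) β ({⟨0, h00⟩} ∆ {⟨(0 : Site 3) + Pi.single 0 (L : ℤ), hL0⟩}) ∅
    with hμ₀
  set μ₁ := doubleCurrentMeasure (boxG n) β
    ({⟨Pi.single 1 1, h10⟩} ∆ {⟨(Pi.single 1 1 : Site 3) + Pi.single 0 (L : ℤ), hL1⟩}) ∅ with hμ₁
  set D : Set ((Current (boxG n) × Current (boxG n)) × (Current (boxG n) × Current (boxG n))) :=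
    {pq | ∀ u : ↥(box 3 n), ¬ (pq.1 ∈ tracedConn (boxG n) ⟨0, h00⟩ u ∧
      pq.2 ∈ tracedConn (boxG n) ⟨Pi.single 1 1, h10⟩ u)} with hD
  -- the two axis walks
  have hc0 : ∀ k : ℕ, k ≤ L → (0 : Site 3) + Pi.single 0 (k : ℤ) ∈ box 3 n := fun k hk => by
    simpa using axis_mem_box hL hn 0 (Or.inl rfl) k hk
  have hc1 : ∀ k : ℕ, k ≤ L → (Pi.single 1 1 : Site 3) + Pi.single 0 (k : ℤ) ∈ box 3 n := fun k hk =>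
    axis_mem_box hL hn 1 (Or.inr rfl) k hk
  obtain ⟨p₀, hp₀⟩ := exists_axisWalk n 0 h00 L hc0 L le_rfl
  obtain ⟨p₁, hp₁⟩ := exists_axisWalk n (Pi.single 1 1) h10 L hc1 L le_rfl
  -- the two currents
  obtain ⟨m₀, hm₀s, hm₀e⟩ := exists_current_of_walk (boxG n) p₀
  obtain ⟨m₁, hm₁s, hm₁e⟩ := exists_current_of_walk (boxG n) p₁
  rw [symmDiff_comm] at hm₀s hm₁s
  -- confinement of the clusters
  have hS₀ : ∀ e : (boxG n).edgeFinset, (m₀ + 0) e ≠ 0 →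
      ∀ b ∈ (e : Sym2 ↥(box 3 n)), b ∈ {v : ↥(box 3 n) | (v : Site 3) 1 = 0} := by
    intro e he b hb
    rw [add_zero] at he
    have hed := hm₀e e he
    obtain ⟨b', hb'⟩ := Sym2.mem_iff_exists.1 hb
    rw [hb'] at hed
    have h := hp₀ b (p₀.fst_mem_support_of_mem_edges hed)
    rw [Pi.zero_apply] at h
    exact h
  have hS₁ : ∀ e : (boxG n).edgeFinset, (m₁ + 0) e ≠ 0 →
      ∀ b ∈ (e : Sym2 ↥(box 3 n)), b ∈ {v : ↥(box 3 n) | (v : Site 3) 1 = 1} := by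
    intro e he b hb
    rw [add_zero] at he
    have hed := hm₁e e he
    obtain ⟨b', hb'⟩ := Sym2.mem_iff_exists.1 hb
    rw [hb'] at hed
    have h := hp₁ b (p₁.fst_mem_support_of_mem_edges hed)
    rw [Pi.single_eq_same] at h
    exact h
  -- the atom lies in the event
  have hmem : ((m₀, (0 : Current (boxG n))), (m₁, (0 : Current (boxG n)))) ∈ D := by
    intro u ⟨hu₀, hu₁⟩
    have h0 : (u : Site 3) 1 = 0 :=
      mem_of_tracedConn (boxG n) hS₀ hu₀ (show ((0 : Site 3)) 1 = 0 from rfl)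
    have h1 : (u : Site 3) 1 = 1 :=
      mem_of_tracedConn (boxG n) hS₁ hu₁ (show (Pi.single 1 1 : Site 3) 1 = 1 from Pi.single_eq_same 1 1)
    rw [h0] at h1
    exact zero_ne_one h1
  have hsub : ({(m₀, (0 : Current (boxG n)))} : Set (Current (boxG n) × Current (boxG n))) ×ˢ
      ({(m₁, (0 : Current (boxG n)))} : Set (Current (boxG n) × Current (boxG n))) ⊆ D := by
    rw [Set.singleton_prod_singleton]
    exact Set.singleton_subset_iff.2 hmem
  -- positivity
  have hpos₀ : 0 < μ₀.real {(m₀, (0 : Current (boxG n)))} :=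
    doubleCurrentMeasure_real_singleton_pos (boxG n) hβ (m₀, (0 : Current (boxG n))) hm₀s Current.sources_zero
  have hpos₁ : 0 < μ₁.real {(m₁, (0 : Current (boxG n)))} :=
    doubleCurrentMeasure_real_singleton_pos (boxG n) hβ (m₁, (0 : Current (boxG n))) hm₁s Current.sources_zero
  have hZ₀ : currentSum (boxG n) β ({⟨0, h00⟩} ∆ {⟨(0 : Site 3) + Pi.single 0 (L : ℤ), hL0⟩}) ≠ 0 :=
    (currentSum_pos_of_exists _ hβ ⟨m₀, hm₀s⟩).ne'
  have hZ₁ : currentSum (boxG n) β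
      ({⟨Pi.single 1 1, h10⟩} ∆ {⟨(Pi.single 1 1 : Site 3) + Pi.single 0 (L : ℤ), hL1⟩}) ≠ 0 :=
    (currentSum_pos_of_exists _ hβ ⟨m₁, hm₁s⟩).ne'
  have hZe : currentSum (boxG n) β ∅ ≠ 0 := (currentSum_empty_pos' _ β).ne'
  haveI : IsProbabilityMeasure μ₀ := isProbabilityMeasure_doubleCurrentMeasure_holds (boxG n) hβ.le hZ₀ hZe
  haveI : IsProbabilityMeasure μ₁ := isProbabilityMeasure_doubleCurrentMeasure_holds (boxG n) hβ.le hZ₁ hZe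
  have hprod : (μ₀.prod μ₁).real (({(m₀, (0 : Current (boxG n)))} : Set (Current (boxG n) × Current (boxG n))) ×ˢ
      ({(m₁, (0 : Current (boxG n)))} : Set (Current (boxG n) × Current (boxG n)))) =
      μ₀.real {(m₀, (0 : Current (boxG n)))} * μ₁.real {(m₁, (0 : Current (boxG n)))} :=
    measureReal_prod_prod _ _
  calc (0 : ℝ) < μ₀.real {(m₀, (0 : Current (boxG n)))} * μ₁.real {(m₁, (0 : Current (boxG n)))} :=
        mul_pos hpos₀ hpos₁
    _ = _ := hprod.symm
    _ ≤ (μ₀.prod μ₁).real D := measureReal_mono hsub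

/-- **Tightness at every finite stage** (`0 < D_n(x)`), in the crux's binder shape: `β > 0`,
`x = L e₀`, `L ≤ n`, `1 ≤ n`, nails `o, a, y, y'` with the crux's coordinate hypotheses. -/
theorem disjoint_prob_pos {n L : ℕ} (hL : L ≤ n) (hn : 1 ≤ n) {β : ℝ} (hβ : 0 < β)
    (o a y y' : ↥(box 3 n)) (ho : (o : Site 3) = 0) (ha : (a : Site 3) = Pi.single 1 1)
    (hy : (y : Site 3) = Pi.single 0 (L : ℤ)) (hy' : (y' : Site 3) = Pi.single 0 (L : ℤ) + Pi.single 1 1) :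
    0 < ((doubleCurrentMeasure (boxG n) β ({o} ∆ {y}) ∅).prod
          (doubleCurrentMeasure (boxG n) β ({a} ∆ {y'}) ∅)).real
        {pq | ∀ u : ↥(box 3 n), ¬ (pq.1 ∈ tracedConn (boxG n) o u ∧ pq.2 ∈ tracedConn (boxG n) a u)} := by
  have hL0 : (0 : Site 3) + Pi.single 0 (L : ℤ) ∈ box 3 n := by
    simpa using axis_mem_box hL hn 0 (Or.inl rfl) L le_rfl
  have hL1 : (Pi.single 1 1 : Site 3) + Pi.single 0 (L : ℤ) ∈ box 3 n :=
    axis_mem_box hL hn 1 (Or.inr rfl) L le_rfl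
  have h00 : (0 : Site 3) ∈ box 3 n := zero_mem_box 3 n
  have h10 : (Pi.single 1 1 : Site 3) ∈ box 3 n := by
    simpa using axis_mem_box hL hn 1 (Or.inr rfl) 0 (Nat.zero_le L)
  have hoe : o = ⟨0, h00⟩ := Subtype.ext ho
  have hae : a = ⟨Pi.single 1 1, h10⟩ := Subtype.ext ha
  have hye : y = ⟨(0 : Site 3) + Pi.single 0 (L : ℤ), hL0⟩ := Subtype.ext (by simp [hy])
  have hy'e : y' = ⟨(Pi.single 1 1 : Site 3) + Pi.single 0 (L : ℤ), hL1⟩ :=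
    Subtype.ext (by rw [hy', add_comm])
  subst hoe hae hye hy'e
  exact disjoint_prob_pos_canonical hL hn hβ h00 h10 hL0 hL1

end Tight

section EpsZero

/-- `RungOneAdjacentMerging` with `≤ ε` (for every `ε > 0`) replaced by `≤ 0` (the `∀ ε, 0 < ε →`
deleted and `ε := 0`), everything else verbatim: "far duplicated clusters are a.s. NOT disjoint at
every late finite stage". -/
def RungOneAdjacentMergingEpsZero : Prop :=
  ∃ R : ℝ, ∀ x : Site 3, R ≤ ‖x‖ → ∃ n₀ : ℕ, ∀ n : ℕ, n₀ ≤ n → ∀ o a y y' : ↥(box 3 n), (o : Site 3) = 0 → (a : Site 3) = Pi.single 1 1 → (y : Site 3) = x → (y' : Site 3) = x + Pi.single 1 1 → ((doubleCurrentMeasure ((zdGraph 3).comap (Subtype.val : ↥(box 3 n) → Site 3)) (criticalBeta 3) ({o} ∆ {y}) ∅).prod (doubleCurrentMeasure ((zdGraph 3).comap (Subtype.val : ↥(box 3 n) → Site 3)) (criticalBeta 3) ({a} ∆ {y'}) ∅)).real {pq | ∀ u : ↥(box 3 n), ¬ (pq.1 ∈ tracedConn ((zdGraph 3).comap (Subtype.val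 : ↥(box 3 n) → Site 3)) o u ∧ pq.2 ∈ tracedConn ((zdGraph 3).comap (Subtype.val : ↥(box 3 n) → Site 3)) a u)} ≤ 0

/-- The `ε = 0` version implies the crux (it is the crux with every `ε` served by `0 ≤ ε`). -/
theorem rungOneAdjacentMerging_of_epsZero (h : RungOneAdjacentMergingEpsZero) :
    Summit.CriticalPhenomena.Ising3DConformalLimit.Theses.EnergyNotSigmaSquared.RungOneAdjacentMerging := by
  obtain ⟨R, hR⟩ := h
  intro ε hε
  refine ⟨R, fun x hx => ?_⟩
  obtain ⟨n₀, hn₀⟩ := hR x hx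
  exact ⟨n₀, fun n hn o a y y' ho ha hy hy' => (hn₀ n hn o a y y' ho ha hy hy').trans hε.le⟩

/-- **The `ε = 0` strengthening is FALSE** (`0 < D_n(x)` at every finite stage, `disjoint_prob_pos`,
with `β_c(3) > 0` from the tree's `criticalBeta_pos_holds`): witness `x = L e₀`, `L = max ⌈R⌉₊ 1`,
`n = max n₀ L`.  Together with the proved crux: `D_n(x)` is positive at every finite stage and tends
to `0` only in the double limit. -/
theorem not_rungOneAdjacentMerging_eps_zero : ¬ RungOneAdjacentMergingEpsZero := by
  rintro ⟨R, hR⟩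
  have hβ : 0 < criticalBeta 3 := criticalBeta_pos_holds (d := 3) (by norm_num)
  set L : ℕ := max ⌈R⌉₊ 1 with hLdef
  have hL1 : 1 ≤ L := le_max_right _ _
  have hxR : R ≤ ‖(Pi.single 0 (L : ℤ) : Site 3)‖ := by
    rw [Pi.norm_single, Int.norm_natCast]
    exact (Nat.le_ceil R).trans (by exact_mod_cast le_max_left _ _)
  obtain ⟨n₀, hn₀⟩ := hR (Pi.single 0 (L : ℤ)) hxR
  set n : ℕ := max n₀ L with hndef
  have hLn : L ≤ n := le_max_right _ _
  have hn1 : 1 ≤ n := hL1.trans hLn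
  have h00 : (0 : Site 3) ∈ box 3 n := zero_mem_box 3 n
  have h10 : (Pi.single 1 1 : Site 3) ∈ box 3 n := by
    simpa using axis_mem_box hLn hn1 1 (Or.inr rfl) 0 (Nat.zero_le L)
  have hL0 : (Pi.single 0 (L : ℤ) : Site 3) ∈ box 3 n := by
    simpa using axis_mem_box hLn hn1 0 (Or.inl rfl) L le_rfl
  have hL1' : (Pi.single 0 (L : ℤ) + Pi.single 1 1 : Site 3) ∈ box 3 n := by
    simpa [add_comm] using axis_mem_box hLn hn1 1 (Or.inr rfl) L le_rfl
  have key := hn₀ n (le_max_left _ _) ⟨0, h00⟩ ⟨Pi.single 1 1, h10⟩ ⟨Pi.single 0 (L : ℤ), hL0⟩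
    ⟨Pi.single 0 (L : ℤ) + Pi.single 1 1, hL1'⟩ rfl rfl rfl rfl
  have pos := disjoint_prob_pos hLn hn1 hβ ⟨0, h00⟩ ⟨Pi.single 1 1, h10⟩ ⟨Pi.single 0 (L : ℤ), hL0⟩
    ⟨Pi.single 0 (L : ℤ) + Pi.single 1 1, hL1'⟩ rfl rfl rfl rfl
  linarith

end EpsZero


/-! ## §B The rate form (natural strengthening; OPEN, out of reach of the second-moment line) -/

section Power

/-- **RungOnePower** (gen-1 name kept): the duplicated-system GAP — the disjointness probability is
at most `C‖x‖^{-κ'}` eventually in `n`, for some `κ' > 0`. This is the criticality-SENSITIVE form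
(false for `β < β_c`, where the decay is `(log ‖x‖)^{-2}`, Ott–Velenik 2019 Thm 1.2), and the one a
calibration of `κ = 2(Δ_ε - 2Δ_σ)` would need; the proved crux is its `o(1)` shadow. -/
def RungOnePower : Prop :=
  ∃ κ C : ℝ, 0 < κ ∧ ∀ x : Site 3, x ≠ 0 → ∃ n₀ : ℕ, ∀ n : ℕ, n₀ ≤ n → ∀ o a y y' : ↥(box 3 n), (o : Site 3) = 0 → (a : Site 3) = Pi.single 1 1 → (y : Site 3) = x → (y' : Site 3) = x + Pi.single 1 1 → ((doubleCurrentMeasure ((zdGraph 3).comap (Subtype.val : ↥(box 3 n) → Site 3)) (criticalBeta 3) ({o} ∆ {y}) ∅).prod (doubleCurrentMeasure ((zdGraph 3).comap (Subtype.val : ↥(box 3 n) → Site 3)) (criticalBeta 3) ({a} ∆ {y'}) ∅)).real {pq | ∀ u : ↥(box 3 n), ¬ (pq.1 ∈ tracedConn ((zdGraph 3).comap (Subtype.val : ↥(box 3 n) → Site 3)) o u ∧ pq.2 ∈ tracedConn ((zdGraph 3).comap (Subtype.val : ↥(box 3 n) → Site 3)) a u)} ≤ C * (‖x‖ : ℝ)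 ^ (-κ)

/-- The rate form implies the crux (`C‖x‖^{-κ} → 0`). -/
theorem rungOneAdjacentMerging_of_power (h : RungOnePower) :
    Summit.CriticalPhenomena.Ising3DConformalLimit.Theses.EnergyNotSigmaSquared.RungOneAdjacentMerging := by
  obtain ⟨κ, C, hκ, hP⟩ := h
  intro ε hε
  have ht : Filter.Tendsto (fun r : ℝ => C * r ^ (-κ)) Filter.atTop (nhds 0) := by
    simpa using (tendsto_rpow_neg_atTop hκ).const_mul C
  obtain ⟨R₀, hR₀⟩ := Filter.eventually_atTop.1 (ht.eventually (Iic_mem_nhds hε))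
  refine ⟨max R₀ 1, fun x hx => ?_⟩
  have hx1 : (1 : ℝ) ≤ ‖x‖ := le_trans (le_max_right _ _) hx
  have hx0 : x ≠ 0 := by
    intro h0
    rw [h0, norm_zero] at hx1
    linarith
  obtain ⟨n₀, hn₀⟩ := hP x hx0
  refine ⟨n₀, fun n hn o a y y' ho ha hy hy' => (hn₀ n hn o a y y' ho ha hy hy').trans ?_⟩
  exact hR₀ ‖x‖ (le_trans (le_max_left _ _) hx)

end Power

end Summit.CriticalPhenomena.Ising3DConformalLimit.Cruxes.RungOneAdjacentMerging.Disproof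

end
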